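import Mathlib.Analysis.Calculus.InverseFunctionTheorem.ContDiff
import Mathlib.Analysis.Calculus.Deriv.Basic
import Mathlib.MeasureTheory.Function.Jacobian
import HarnessLib

/-!
# One-parameter transversality in the plane (Sard in dimension one)

Topic `Literature/Topology/FourManifolds`; a real-analysis lemma of general position, the
one-dimensional parametric case of Thom's transversality theorem (Hirsch, *Differential
Topology* (1976), Ch. 3 §2, Thm. 2.7, from Sard's theorem §1 Thm. 1.3), proved from Mathlib's
change-of-variables inequality (`MeasureTheory.addHaar_image_eq_zero_of_det_fderivWithin_eq_zero`,
which contains Sard's theorem for maps `ℝⁿ → ℝⁿ`) and the inverse function theorem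
(`ContDiffAt.toOpenPartialHomeomorph`).  **Everything here is proved; no definition and no named
fact is introduced.**

Let `U ⊆ ℝ²` be open and `H : ℝ² → ℝ` be `C¹` near each point of `U`; write `∂₁H q = DH(q)(1,0)`,
`∂₂H q = DH(q)(0,1)`, and think of `s ↦ (θ ↦ H (θ, s))` as a one-parameter family of functions
of `θ`.

* `OneParamTransversality.volume_image_setOf_deriv_eq_zero` — Sard in dimension one: the
  critical values of a differentiable `g : ℝ → ℝ` (on an arbitrary set of points of
  differentiability) form a null set.
* `OneParamTransversality.exists_nhds_volume_eq_zero` — local form: if `∂₂H ≠ 0` on `U`, every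
  point of `U` has a neighbourhood `O` such that `{s | ∃ θ, (θ, s) ∈ O, H = 0, ∂₁H = 0}` is null
  (on `O` the zero set is a graph `s = g θ` with `g' = 0` exactly where `∂₁H = 0`).
* `OneParamTransversality.volume_setOf_tangency_eq_zero` — **if `∂₂H q ≠ 0` at every zero
  `q ∈ U` of `H` with `∂₁H q = 0` (e.g. `DH ≠ 0` on the zero set), then the set of parameters `s`
  for which `θ ↦ H (θ, s)` has a degenerate zero in `U` is Lebesgue-null** (Lindelöf + local form).
* `OneParamTransversality.exists_near_forall_nondegenerate` — hence, for countably many such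
  constraints `(H k, U k)`, every interval of parameters contains an `s` that is nondegenerate
  for all of them.

## Use: general position of curves against circles on a surface

In tubular coordinates `(θ, h)` around an embedded circle `m` of a surface, a smooth family of
curves `c_s` (`s` a real parameter, e.g. the height of a parallel copy of another circle pushed
by a diffeomorphism) reads near `m` as `θ ↦ (Θ(θ, s), H(θ, s))`; `c_s` meets `m` at the zeros of
`H (·, s)` and meets it transversally iff these zeros are nondegenerate.  When the family map
`(θ, s) ↦ c_s(θ)` is a local diffeomorphism, `DH ≠ 0` everywhere, and the theorem says
`c_s ⋔ m` for almost every `s`; with finitely many circles and finitely many families, some `s`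
arbitrarily close to `0` works for all pairs.  This is the general-position step of the wave
argument for cut systems of a handlebody (Hensel (2020), §5; the meridian-disc half of
Griffiths' theorem, `HandlebodyKernelExtensionTorelli.lean`).

## References

* M. W. Hirsch, *Differential Topology*, GTM 33 (1976), Ch. 3 §1, Thm. 1.3 (Sard), §2,
  Thm. 2.7 (parametric transversality). [HirschDT1976]
* S. Hensel, *A primer on handlebody groups* (2020), §5. [Hensel2020HandlebodyPrimer]
-/

open Set Function Filter MeasureTheory
open scoped Topology

noncomputable section

namespace Literature.Topology.FourManifolds

namespace OneParamTransversality

/-! ### Sard's theorem for functions of one real variable -/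

/-- The determinant of the Fréchet derivative of a real function of one variable is its
derivative. [folklore] -/
theorem det_fderiv_eq_deriv (g : ℝ → ℝ) (θ : ℝ) : (fderiv ℝ g θ).det = deriv g θ := by
  have h1 : ((fderiv ℝ g θ : ℝ →L[ℝ] ℝ) : ℝ →ₗ[ℝ] ℝ) = deriv g θ • LinearMap.id := by
    ext
    simp [← toSpanSingleton_deriv]
  rw [ContinuousLinearMap.det, h1, LinearMap.det_smul, LinearMap.det_id, Module.finrank_self]
  simp

/-- **Sard's theorem in dimension one.**  For `g : ℝ → ℝ` differentiable at every point of an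
open set `T`, the set of critical values `g {θ ∈ T | g' θ = 0}` is Lebesgue-null (Mathlib's
`addHaar_image_eq_zero_of_det_fderivWithin_eq_zero`). [folklore] -/
theorem volume_image_setOf_deriv_eq_zero {g : ℝ → ℝ} {T : Set ℝ}
    (hg : ∀ θ ∈ T, DifferentiableAt ℝ g θ) :
    volume (g '' {θ ∈ T | deriv g θ = 0}) = 0 := by
  refine addHaar_image_eq_zero_of_det_fderivWithin_eq_zero (μ := volume)
    (f' := fun θ => fderiv ℝ g θ) (fun θ hθ => (hg θ hθ.1).hasFDerivAt.hasFDerivWithinAt)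
    fun θ hθ => ?_
  rw [det_fderiv_eq_deriv]
  exact hθ.2

/-! ### The linear algebra of `(x, y) ↦ (x, ∂₁ x + ∂₂ y)` -/

/-- A linear form on `ℝ²` in coordinates. [folklore] -/
theorem apply_prod_eq (D : ℝ × ℝ →L[ℝ] ℝ) (x y : ℝ) : D (x, y) = x * D (1, 0) + y * D (0, 1) := by
  have h : ((x, y) : ℝ × ℝ) = x • ((1 : ℝ), (0 : ℝ)) + y • ((0 : ℝ), (1 : ℝ)) := by
    ext <;> simp
  rw [h, map_add, map_smul, map_smul, smul_eq_mul, smul_eq_mul]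

/-- The map `(x, y) ↦ (x, D (x, y))` is injective as soon as `D (0, 1) ≠ 0`. [folklore] -/
theorem injective_fst_prod (D : ℝ × ℝ →L[ℝ] ℝ) (hD : D (0, 1) ≠ 0) :
    Injective ((ContinuousLinearMap.fst ℝ ℝ ℝ).prod D) := by
  rw [injective_iff_map_eq_zero]
  rintro ⟨x, y⟩ h
  simp only [ContinuousLinearMap.prod_apply, ContinuousLinearMap.coe_fst', Prod.mk_eq_zero] at h
  obtain ⟨hx, hDxy⟩ := h
  subst hx
  rw [apply_prod_eq, zero_mul, zero_add, mul_eq_zero] at hDxy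
  rcases hDxy with hy | h0
  · simp [hy]
  · exact absurd h0 hD

/-- **The shear equivalence.**  For a linear form `D` on `ℝ²` with `D (0, 1) ≠ 0` the map
`(x, y) ↦ (x, D (x, y))` is a continuous linear automorphism `e` of `ℝ²`, and the second
coordinate of `e⁻¹ (1, 0)` vanishes as soon as `D (1, 0) = 0` (it is `-D(1,0)/D(0,1)`).
[folklore] -/
theorem exists_shearEquiv (D : ℝ × ℝ →L[ℝ] ℝ) (hD : D (0, 1) ≠ 0) :
    ∃ e : (ℝ × ℝ) ≃L[ℝ] (ℝ × ℝ),
      (e : ℝ × ℝ →L[ℝ] ℝ × ℝ) = (ContinuousLinearMap.fst ℝ ℝ ℝ).prod D ∧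
      (D (1, 0) = 0 → (e.symm (1, 0)).2 = 0) := by
  set e : (ℝ × ℝ) ≃L[ℝ] (ℝ × ℝ) :=
    (LinearMap.linearEquivOfInjective
      (((ContinuousLinearMap.fst ℝ ℝ ℝ).prod D : ℝ × ℝ →L[ℝ] ℝ × ℝ) : ℝ × ℝ →ₗ[ℝ] ℝ × ℝ)
      (injective_fst_prod D hD) rfl).toContinuousLinearEquiv with he_def
  have he : ∀ v, e v = (v.1, D v) := fun v => rfl
  refine ⟨e, ContinuousLinearMap.ext fun v => he v, fun h1 => ?_⟩
  set w := e.symm (1, 0) with hw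
  have h : e w = (1, 0) := e.apply_symm_apply (1, 0)
  rw [he, Prod.mk.injEq] at h
  obtain ⟨hw1, hDw⟩ := h
  have : D w = D (w.1, w.2) := rfl
  rw [this, apply_prod_eq, hw1, h1, mul_zero, zero_add, mul_eq_zero] at hDw
  rcases hDw with h | h
  · exact h
  · exact absurd h hD

/-! ### The local statement: an implicit function near a point with `∂₂H ≠ 0` -/

/-- **Local form.**  Let `H` be `C¹` near every point of the open set `U ⊆ ℝ²` with
`∂₂H ≠ 0` on `U` (`∂₂H q = DH(q)(0, 1)`).  Then every `p ∈ U` has an open neighbourhood `O`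
such that the parameters `s` of the points `(θ, s) ∈ O` with `H = 0` and `∂₁H = 0` form a
Lebesgue-null set.  Proof: by the inverse function theorem for the shear
`Φ (θ, s) = (θ, H (θ, s))` at `p`, on `O = Φ.source ∩ U` the zero set of `H` is the graph
`s = g θ`, `g θ = (Φ⁻¹ (θ, 0)).2`, of a function differentiable where defined, with
`g' θ = ((DΦ)⁻¹ (1, 0)).2`, which vanishes exactly at the points where `∂₁H = 0`
(`shearEquiv_symm_snd_eq_zero`); Sard in dimension one (`volume_image_setOf_deriv_eq_zero`).
[folklore] -/
theorem exists_nhds_volume_eq_zero {H : ℝ × ℝ → ℝ} {U : Set (ℝ × ℝ)} (hU : IsOpen U)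
    (hH : ∀ p ∈ U, ContDiffAt ℝ 1 H p) (h2 : ∀ q ∈ U, fderiv ℝ H q (0, 1) ≠ 0) {p : ℝ × ℝ}
    (hp : p ∈ U) :
    ∃ O : Set (ℝ × ℝ), IsOpen O ∧ p ∈ O ∧
      volume (Prod.snd '' {q ∈ O | H q = 0 ∧ fderiv ℝ H q (1, 0) = 0}) = 0 := by
  -- the shear `Φ (θ, s) = (θ, H (θ, s))`, its derivative `E q` at `q ∈ U`
  set Φ : ℝ × ℝ → ℝ × ℝ := fun q => (q.1, H q) with hΦ_def
  choose E hEcoe hEsnd using fun (q : ℝ × ℝ) (hq : q ∈ U) => exists_shearEquiv (fderiv ℝ H q) (h2 q hq)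
  have hΦd : ∀ q (hq : q ∈ U), HasFDerivAt Φ (E q hq : ℝ × ℝ →L[ℝ] ℝ × ℝ) q := fun q hq => by
    rw [hEcoe q hq]
    exact hasFDerivAt_fst.prodMk ((hH q hq).differentiableAt one_ne_zero).hasFDerivAt
  have hΦc : ContDiffAt ℝ 1 Φ p := contDiffAt_fst.prodMk (hH p hp)
  -- inverse function theorem at `p`
  set Ψ := hΦc.toOpenPartialHomeomorph Φ (hΦd p hp) one_ne_zero with hΨ_def
  have hΨΦ : ∀ q, Ψ q = Φ q := fun q => rfl
  have hpΨ : p ∈ Ψ.source := hΦc.mem_toOpenPartialHomeomorph_source (hΦd p hp) one_ne_zero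
  -- the neighbourhood
  set O : Set (ℝ × ℝ) := Ψ.source ∩ U with hO_def
  have hO : IsOpen O := Ψ.open_source.inter hU
  refine ⟨O, hO, ⟨hpΨ, hp⟩, ?_⟩
  -- the implicit function `g θ = (Ψ⁻¹ (θ, 0)).2` on `T = {θ | (θ, 0) ∈ Ψ.target, Ψ⁻¹ (θ, 0) ∈ O}`
  set g : ℝ → ℝ := fun θ => (Ψ.symm (θ, 0)).2 with hg_def
  set T : Set ℝ := (fun θ : ℝ => ((θ, (0 : ℝ)) : ℝ × ℝ)) ⁻¹' (Ψ.target ∩ Ψ.symm ⁻¹' O) with hT_def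
  -- the derivative of `g` on `T`
  have hgd : ∀ θ (hθ : θ ∈ T), HasDerivAt g (((E (Ψ.symm (θ, 0)) hθ.2.2).symm (1, 0)).2) θ := by
    intro θ hθ
    have htgt : ((θ, (0 : ℝ)) : ℝ × ℝ) ∈ Ψ.target := hθ.1
    have hqU : Ψ.symm (θ, 0) ∈ U := hθ.2.2
    have hsymm : HasFDerivAt Ψ.symm ((E (Ψ.symm (θ, 0)) hqU).symm : ℝ × ℝ →L[ℝ] ℝ × ℝ) (θ, 0) :=
      Ψ.hasFDerivAt_symm htgt (hΦd _ hqU)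
    have hinl : HasFDerivAt (fun θ' : ℝ => ((θ', (0 : ℝ)) : ℝ × ℝ))
        (ContinuousLinearMap.inl ℝ ℝ ℝ) θ := hasFDerivAt_prodMk_left θ (0 : ℝ)
    have hcomp : HasFDerivAt (fun θ' : ℝ => Ψ.symm (θ', 0))
        (((E (Ψ.symm (θ, 0)) hqU).symm : ℝ × ℝ →L[ℝ] ℝ × ℝ).comp
          (ContinuousLinearMap.inl ℝ ℝ ℝ)) θ := hsymm.comp θ hinl
    have hsnd : HasFDerivAt g
        ((ContinuousLinearMap.snd ℝ ℝ ℝ).comp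
          ((((E (Ψ.symm (θ, 0)) hqU).symm : ℝ × ℝ →L[ℝ] ℝ × ℝ).comp
            (ContinuousLinearMap.inl ℝ ℝ ℝ)))) θ := hcomp.snd
    have hder := hsnd.hasDerivAt
    simpa using hder
  have hgdiff : ∀ θ ∈ T, DifferentiableAt ℝ g θ := fun θ hθ => (hgd θ hθ).differentiableAt
  -- the tangency parameters are critical values of `g`
  have hsub : Prod.snd '' {q ∈ O | H q = 0 ∧ fderiv ℝ H q (1, 0) = 0} ⊆
      g '' {θ ∈ T | deriv g θ = 0} := by
    rintro _ ⟨q, ⟨hqO, hq0, hq1⟩, rfl⟩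
    have hqs : q ∈ Ψ.source := hqO.1
    have hΨq : Ψ q = (q.1, 0) := by rw [hΨΦ, hΦ_def]; simp [hq0]
    have htgt : ((q.1, (0 : ℝ)) : ℝ × ℝ) ∈ Ψ.target := hΨq ▸ Ψ.map_source hqs
    have hsymmq : Ψ.symm (q.1, 0) = q := by rw [← hΨq]; exact Ψ.left_inv hqs
    have hθT : q.1 ∈ T := ⟨htgt, by show Ψ.symm (q.1, 0) ∈ O; rw [hsymmq]; exact hqO⟩
    refine ⟨q.1, ⟨hθT, ?_⟩, by show (Ψ.symm (q.1, 0)).2 = q.2; rw [hsymmq]⟩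
    rw [(hgd q.1 hθT).deriv]
    -- `E` is evaluated at `Ψ.symm (q.1, 0) = q`, where `∂₁H = 0`
    have key : ∀ (q' : ℝ × ℝ) (hq' : q' ∈ U), q' = q → ((E q' hq').symm (1, 0)).2 = 0 := by
      rintro q' hq' rfl
      exact hEsnd q' hq' hq1
    exact key _ hθT.2.2 hsymmq
  exact measure_mono_null hsub (volume_image_setOf_deriv_eq_zero hgdiff)

/-! ### The global statement -/

/-- Continuity of `q ↦ fderiv ℝ H q` on an open set on which `H` is `C¹`. [folklore] -/
theorem continuousOn_fderiv_of_contDiffAt {H : ℝ × ℝ → ℝ} {U : Set (ℝ × ℝ)}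
    (hH : ∀ p ∈ U, ContDiffAt ℝ 1 H p) : ContinuousOn (fderiv ℝ H) U := fun p hp =>
  ((hH p hp).continuousAt_fderiv one_ne_zero).continuousWithinAt

/-- **One-parameter transversality (Sard in dimension one).**  Let `U ⊆ ℝ²` be open and
`H : ℝ² → ℝ` be `C¹` near each point of `U`, with the transversality hypothesis that at every
zero `q ∈ U` of `H` with `∂₁H q = 0` one has `∂₂H q ≠ 0` (e.g. `DH ≠ 0` on the zero set).  Then
the set of parameters `s` for which the curve `θ ↦ H (θ, s)` has a degenerate zero in `U` —
some `(θ, s) ∈ U` with `H (θ, s) = 0` and `∂₁H (θ, s) = 0` — is Lebesgue-null.  In particular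
its complement is dense: arbitrarily close to any `s₀` there are parameters `s` for which `0` is
a regular value of `H (·, s)` on `{θ | (θ, s) ∈ U}`.

Typical use (general position of curves on a surface): `H (θ, s)` = the height, in tubular
coordinates around an embedded circle `m`, of the point of parameter `θ` on the member `c_s` of
a smooth family of curves; `H` is then a submersion wherever the family map `(θ, s) ↦ c_s(θ)`
is a local diffeomorphism, and the conclusion says that `c_s ⋔ m` for almost every `s`
(R. Thom's transversality in the plane; Hirsch, *Differential Topology* (1976), Ch. 3 §2,
Thm. 2.7, of which this is the one-dimensional parametric case).  Proof: countably many of the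
neighbourhoods of `exists_nhds_volume_eq_zero` cover the tangency set (Lindelöf).
[cite: HirschDT1976, Ch. 3 §1, Thm. 1.3 (Sard) and §2, Thm. 2.7] -/
theorem volume_setOf_tangency_eq_zero {H : ℝ × ℝ → ℝ} {U : Set (ℝ × ℝ)} (hU : IsOpen U)
    (hH : ∀ p ∈ U, ContDiffAt ℝ 1 H p)
    (hreg : ∀ q ∈ U, H q = 0 → fderiv ℝ H q (1, 0) = 0 → fderiv ℝ H q (0, 1) ≠ 0) :
    volume {s : ℝ | ∃ θ : ℝ, (θ, s) ∈ U ∧ H (θ, s) = 0 ∧ fderiv ℝ H (θ, s) (1, 0) = 0} = 0 := by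
  -- shrink to the open set where `∂₂H ≠ 0`
  set U' : Set (ℝ × ℝ) := U ∩ (fun q => fderiv ℝ H q (0, 1)) ⁻¹' {x | x ≠ 0} with hU'_def
  have hU' : IsOpen U' := by
    refine ContinuousOn.isOpen_inter_preimage ?_ hU isOpen_ne
    exact ((continuousOn_fderiv_of_contDiffAt hH).clm_apply continuousOn_const)
  have hH' : ∀ p ∈ U', ContDiffAt ℝ 1 H p := fun p hp => hH p hp.1
  have h2 : ∀ q ∈ U', fderiv ℝ H q (0, 1) ≠ 0 := fun q hq => hq.2
  -- the tangency set `K ⊆ U'` and its neighbourhoods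
  set K : Set (ℝ × ℝ) := {q ∈ U | H q = 0 ∧ fderiv ℝ H q (1, 0) = 0} with hK_def
  have hKU' : K ⊆ U' := fun q hq => ⟨hq.1, hreg q hq.1 hq.2.1 hq.2.2⟩
  choose O hO hpO hnull using fun q : K => exists_nhds_volume_eq_zero hU' hH' h2 (hKU' q.2)
  -- a countable subcover (Lindelöf)
  obtain ⟨Tc, hTc, hcov⟩ := TopologicalSpace.isOpen_iUnion_countable O hO
  have hKcov : K ⊆ ⋃ q ∈ Tc, O q := by
    intro q hq
    rw [hcov]
    exact mem_iUnion.2 ⟨⟨q, hq⟩, hpO ⟨q, hq⟩⟩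
  -- the tangency parameters lie in the countable union of the local null sets
  have hsub : {s : ℝ | ∃ θ : ℝ, (θ, s) ∈ U ∧ H (θ, s) = 0 ∧ fderiv ℝ H (θ, s) (1, 0) = 0} ⊆
      ⋃ q ∈ Tc, Prod.snd '' {q' ∈ O q | H q' = 0 ∧ fderiv ℝ H q' (1, 0) = 0} := by
    rintro s ⟨θ, hU₀, h0, h1⟩
    have hK : ((θ, s) : ℝ × ℝ) ∈ K := ⟨hU₀, h0, h1⟩
    obtain ⟨q, hq, hmem⟩ := mem_iUnion₂.1 (hKcov hK)
    exact mem_iUnion₂.2 ⟨q, hq, (θ, s), ⟨hmem, h0, h1⟩, rfl⟩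
  refine measure_mono_null hsub ?_
  rw [measure_biUnion_null_iff hTc]
  exact fun q _ => hnull q

/-- **Good parameters exist near any parameter, for countably many constraints at once.**
Under the hypotheses of `volume_setOf_tangency_eq_zero` for each member of a countable family
`(H k, U k)`, every interval `(s₀ - ε, s₀ + ε)` contains a parameter `s` such that, for every
`k`, the function `θ ↦ H k (θ, s)` has only nondegenerate zeros on `{θ | (θ, s) ∈ U k}` (a
countable union of null sets is null, and an interval is not).
[cite: HirschDT1976, Ch. 3 §1, Thm. 1.3 (Sard) and §2, Thm. 2.7] -/
theorem exists_near_forall_nondegenerate {ι : Type*} [Countable ι] {H : ι → ℝ × ℝ → ℝ}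
    {U : ι → Set (ℝ × ℝ)} (hU : ∀ k, IsOpen (U k)) (hH : ∀ k, ∀ p ∈ U k, ContDiffAt ℝ 1 (H k) p)
    (hreg : ∀ k, ∀ q ∈ U k, H k q = 0 → fderiv ℝ (H k) q (1, 0) = 0 →
      fderiv ℝ (H k) q (0, 1) ≠ 0)
    (s₀ : ℝ) {ε : ℝ} (hε : 0 < ε) :
    ∃ s : ℝ, |s - s₀| < ε ∧ ∀ (k : ι) (θ : ℝ), (θ, s) ∈ U k → H k (θ, s) = 0 →
      fderiv ℝ (H k) (θ, s) (1, 0) ≠ 0 := by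
  set B : ι → Set ℝ := fun k =>
    {s : ℝ | ∃ θ : ℝ, (θ, s) ∈ U k ∧ H k (θ, s) = 0 ∧ fderiv ℝ (H k) (θ, s) (1, 0) = 0} with hB
  have hBnull : volume (⋃ k, B k) = 0 :=
    measure_iUnion_null fun k => volume_setOf_tangency_eq_zero (hU k) (hH k) (hreg k)
  have hI : volume (Ioo (s₀ - ε) (s₀ + ε)) ≠ 0 := by
    rw [Real.volume_Ioo]
    simpa using hε
  have hdiff : volume (Ioo (s₀ - ε) (s₀ + ε) \ ⋃ k, B k) ≠ 0 := by
    rwa [measure_sdiff_null hBnull]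
  obtain ⟨s, hsI, hsB⟩ := nonempty_of_measure_ne_zero hdiff
  refine ⟨s, ?_, fun k θ hθU h0 h1 => hsB (mem_iUnion.2 ⟨k, θ, hθU, h0, h1⟩)⟩
  rw [abs_lt]
  constructor <;> linarith [hsI.1, hsI.2]

end OneParamTransversality

end Literature.Topology.FourManifolds

end
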